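import Literature.Topology.FourManifolds.ExportAlgebraAffine
import Mathlib.Analysis.Normed.Operator.ContinuousLinearMap
import HarnessLib

/-!
# Reading a coface's zone from a face: the tangential part and the kernel slope

Topic `Literature/Topology/FourManifolds`; companion of `ExportAlgebraAffine.lean` (secant-affine
charts of the downward sweep in the smoothing of PD homeomorphisms; Munkres, Ann. of Math. 72
(1960), §5; Campbell–D'Onofrio–Vítek (2026), §4).  Through affine chart transitions, the
tangential part seen by the face `τ` of an `x_σ`-preserving stage output with fibre map `φ` is

  `T_τ (x, y) = x + M_E y + J_E (φ (a (x, y), C y))`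

(`tauTangAff`), with fixed continuous linear `M_E`, `J_E` (the `E_τ`-components of the target
transition) and the same affine base-point map `a` and fibre-coordinate map `C` as for the normal
part `tauNormalAff`.  From the pointwise exports of `σ`'s zone at the `σ`-point — (E1)
`‖Dφ (e, 0)‖ ≤ X ‖e‖`, (E4) `‖Dφ (0, z)‖ ≤ X₄ ‖z‖`, (E6) `‖φ‖ ≤ Φ₆` — we derive the flatten-zone
data of `τ`:

* `norm_fderiv_tauTangAff_inl_sub_le` : `‖D T_τ (v, 0) − v‖ ≤ ‖J_E‖ X ‖A (v, 0)‖`;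
* `norm_fderiv_tauTangAff_inr_le` : `‖D T_τ (0, w)‖ ≤ ‖M_E w‖ + ‖J_E‖ (X ‖A (0, w)‖ + X₄ ‖C w‖)`;
* `norm_tauTangAff_sub_fst_le` : `‖T_τ p − p.1‖ ≤ ‖M_E p.2‖ + ‖J_E‖ Φ₆`;
* `tauNormalAff_kernel_slope` : `D N_τ (v, w) = 0 ⟹ c_τ ‖w‖ ≤ ‖J‖ X ‖A (v, 0)‖` whenever
  `c_τ ‖w‖ ≤ ‖D N_τ (0, w)‖` (the fibre lower bound of `ExportAlgebraAffine`).

Chain rule and norm bookkeeping only; the only definition is the explicit function `tauTangAff`;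
no named facts.

## References

* J. R. Munkres, *Obstructions to the smoothing of piecewise-differentiable homeomorphisms*, Ann.
  of Math. (2) 72 (1960), 521–554, §5. [Munkres1960]
* D. Campbell, L. D'Onofrio, T. Vítek, *Diffeomorphic approximation of piecewise affine
  homeomorphisms*, J. Geom. Anal. 36 (2026), §4. [CampbellDonofrioVitek2026]
-/

noncomputable section

open Set Function Metric Filter
open scoped Topology

namespace Literature.Topology.FourManifolds

variable {Eτ : Type*} [NormedAddCommGroup Eτ] [NormedSpace ℝ Eτ]
variable {Eσ : Type*} [NormedAddCommGroup Eσ] [NormedSpace ℝ Eσ]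
variable {Fτ : Type*} [NormedAddCommGroup Fτ] [NormedSpace ℝ Fτ]
variable {Fσ : Type*} [NormedAddCommGroup Fσ] [NormedSpace ℝ Fσ]
variable {Fτ' : Type*} [NormedAddCommGroup Fτ'] [NormedSpace ℝ Fτ']
variable {Fσ' : Type*} [NormedAddCommGroup Fσ'] [NormedSpace ℝ Fσ']

/-- **The tangential part seen by the face `τ` through affine chart transitions**:
`T_τ p = p.1 + M_E p.2 + J_E (φ (a p, C p.2))`. [folklore] -/
def tauTangAff (ME : Fτ →L[ℝ] Eτ) (JE : Fσ' →L[ℝ] Eτ) (a : Eτ × Fτ → Eσ) (C : Fτ →L[ℝ] Fσ)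
    (φ : Eσ × Fσ → Fσ') (p : Eτ × Fτ) : Eτ :=
  p.1 + ME p.2 + JE (φ (a p, C p.2))

variable {ME : Fτ →L[ℝ] Eτ} {JE : Fσ' →L[ℝ] Eτ} {M : Fτ →L[ℝ] Fτ'} {J : Fσ' →L[ℝ] Fτ'}
  {a : Eτ × Fτ → Eσ} {A : (Eτ × Fτ) →L[ℝ] Eσ} {C : Fτ →L[ℝ] Fσ} {φ : Eσ × Fσ → Fσ'} {p : Eτ × Fτ}

/-- **Derivative of the `τ`-tangential part**: with `L = Dφ (a p, C p.2)` and `A = Da (p)`,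
`D T_τ (v, w) = v + M_E w + J_E (L (A (v, w), C w))`. [folklore] -/
theorem hasFDerivAt_tauTangAff (ha : HasFDerivAt a A p) (hφ : DifferentiableAt ℝ φ (a p, C p.2)) :
    HasFDerivAt (tauTangAff ME JE a C φ)
      (ContinuousLinearMap.fst ℝ Eτ Fτ + ME.comp (ContinuousLinearMap.snd ℝ Eτ Fτ) +
        JE.comp ((fderiv ℝ φ (a p, C p.2)).comp (A.prod (C.comp (ContinuousLinearMap.snd ℝ Eτ Fτ))))) p := by
  have h1 : HasFDerivAt (fun q : Eτ × Fτ => ME q.2) (ME.comp (ContinuousLinearMap.snd ℝ Eτ Fτ)) p :=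
    ME.hasFDerivAt.comp p hasFDerivAt_snd
  have h2 : HasFDerivAt (fun q : Eτ × Fτ => (a q, C q.2)) (A.prod (C.comp (ContinuousLinearMap.snd ℝ Eτ Fτ))) p :=
    ha.prodMk (C.hasFDerivAt.comp p hasFDerivAt_snd)
  have h3 : HasFDerivAt (fun q : Eτ × Fτ => JE (φ (a q, C q.2)))
      (JE.comp ((fderiv ℝ φ (a p, C p.2)).comp (A.prod (C.comp (ContinuousLinearMap.snd ℝ Eτ Fτ))))) p :=
    JE.hasFDerivAt.comp p (hφ.hasFDerivAt.comp p h2)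
  exact (hasFDerivAt_fst.add h1).add h3

/-- `D T_τ (v, 0) = v + J_E (L (A (v, 0), 0))`. [folklore] -/
theorem fderiv_tauTangAff_apply_inl (ha : HasFDerivAt a A p) (hφ : DifferentiableAt ℝ φ (a p, C p.2))
    (v : Eτ) :
    fderiv ℝ (tauTangAff ME JE a C φ) p (v, 0) = v + JE (fderiv ℝ φ (a p, C p.2) (A (v, 0), 0)) := by
  rw [(hasFDerivAt_tauTangAff ha hφ).fderiv]
  simp

/-- `D T_τ (0, w) = M_E w + J_E (L (A (0, w), C w))`. [folklore] -/
theorem fderiv_tauTangAff_apply_inr (ha : HasFDerivAt a A p) (hφ : DifferentiableAt ℝ φ (a p, C p.2))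
    (w : Fτ) :
    fderiv ℝ (tauTangAff ME JE a C φ) p (0, w) = ME w + JE (fderiv ℝ φ (a p, C p.2) (A (0, w), C w)) := by
  rw [(hasFDerivAt_tauTangAff ha hφ).fderiv]
  simp

/-- **(Flatten datum `δ`)** `‖D T_τ (v, 0) − v‖ ≤ ‖J_E‖ X ‖A (v, 0)‖` from (E1). [folklore] -/
theorem norm_fderiv_tauTangAff_inl_sub_le (ha : HasFDerivAt a A p) (hφ : DifferentiableAt ℝ φ (a p, C p.2))
    {X : ℝ} (hE1 : ∀ e : Eσ, ‖fderiv ℝ φ (a p, C p.2) (e, 0)‖ ≤ X * ‖e‖) (v : Eτ) :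
    ‖fderiv ℝ (tauTangAff ME JE a C φ) p (v, 0) - v‖ ≤ ‖JE‖ * (X * ‖A (v, 0)‖) := by
  rw [fderiv_tauTangAff_apply_inl ha hφ, add_sub_cancel_left]
  exact (JE.le_opNorm _).trans (mul_le_mul_of_nonneg_left (hE1 _) (norm_nonneg _))

/-- **(Flatten datum `C`)** `‖D T_τ (0, w)‖ ≤ ‖M_E w‖ + ‖J_E‖ (X ‖A (0, w)‖ + X₄ ‖C w‖)` from (E1)
and (E4). [folklore] -/
theorem norm_fderiv_tauTangAff_inr_le (ha : HasFDerivAt a A p) (hφ : DifferentiableAt ℝ φ (a p, C p.2))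
    {X X₄ : ℝ} (hE1 : ∀ e : Eσ, ‖fderiv ℝ φ (a p, C p.2) (e, 0)‖ ≤ X * ‖e‖)
    (hE4 : ∀ z : Fσ, ‖fderiv ℝ φ (a p, C p.2) (0, z)‖ ≤ X₄ * ‖z‖) (w : Fτ) :
    ‖fderiv ℝ (tauTangAff ME JE a C φ) p (0, w)‖ ≤ ‖ME w‖ + ‖JE‖ * (X * ‖A (0, w)‖ + X₄ * ‖C w‖) := by
  rw [fderiv_tauTangAff_apply_inr ha hφ]
  refine (norm_add_le _ _).trans (add_le_add le_rfl ?_)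
  refine (JE.le_opNorm _).trans (mul_le_mul_of_nonneg_left ?_ (norm_nonneg _))
  rw [map_prod_eq_add (fderiv ℝ φ (a p, C p.2))]
  exact (norm_add_le _ _).trans (add_le_add (hE1 _) (hE4 _))

omit [NormedAddCommGroup Eσ] [NormedSpace ℝ Eσ] in
/-- **(Flatten datum `D`)** `‖T_τ p − p.1‖ ≤ ‖M_E p.2‖ + ‖J_E‖ ‖φ (a p, C p.2)‖`. [folklore] -/
theorem norm_tauTangAff_sub_fst_le {Eσ : Type*} {a : Eτ × Fτ → Eσ} {φ : Eσ × Fσ → Fσ'} (p : Eτ × Fτ) :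
    ‖tauTangAff ME JE a C φ p - p.1‖ ≤ ‖ME p.2‖ + ‖JE‖ * ‖φ (a p, C p.2)‖ := by
  rw [tauTangAff, add_assoc, add_sub_cancel_left]
  exact (norm_add_le _ _).trans (add_le_add le_rfl (JE.le_opNorm _))

/-- **(Flatten datum `K`, the kernel slope of `D N_τ`)**: if `D N_τ (v, w) = 0` and the fibre lower
bound `c_τ ‖w‖ ≤ ‖D N_τ (0, w)‖` holds, then `c_τ ‖w‖ ≤ ‖J‖ X ‖A (v, 0)‖` (from (E1)): the kernel
graph over `E_τ` has slope `≤ ‖J‖ X ‖A‖ / c_τ`. [folklore] -/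
theorem tauNormalAff_kernel_slope (ha : HasFDerivAt a A p) (hφ : DifferentiableAt ℝ φ (a p, C p.2))
    {X cτ : ℝ} (hE1 : ∀ e : Eσ, ‖fderiv ℝ φ (a p, C p.2) (e, 0)‖ ≤ X * ‖e‖)
    {v : Eτ} {w : Fτ} (hc : cτ * ‖w‖ ≤ ‖fderiv ℝ (tauNormalAff M J a C φ) p (0, w)‖)
    (h0 : fderiv ℝ (tauNormalAff M J a C φ) p (v, w) = 0) :
    cτ * ‖w‖ ≤ ‖J‖ * (X * ‖A (v, 0)‖) := by
  -- split `(v, w) = (v, 0) + (0, w)` and compute `D N_τ (v, 0) = J (L (A (v,0), 0))`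
  have hsplit : fderiv ℝ (tauNormalAff M J a C φ) p (v, w) =
      fderiv ℝ (tauNormalAff M J a C φ) p (v, 0) + fderiv ℝ (tauNormalAff M J a C φ) p (0, w) := by
    rw [← map_add]; congr 1; ext <;> simp
  have hinl : fderiv ℝ (tauNormalAff M J a C φ) p (v, 0) = J (fderiv ℝ φ (a p, C p.2) (A (v, 0), 0)) := by
    rw [(hasFDerivAt_tauNormalAff ha hφ).fderiv]
    simp
  rw [hsplit, hinl] at h0
  have h1 : ‖fderiv ℝ (tauNormalAff M J a C φ) p (0, w)‖ = ‖J (fderiv ℝ φ (a p, C p.2) (A (v, 0), 0))‖ := by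
    rw [← norm_neg, ← (neg_eq_of_add_eq_zero_right h0), neg_neg]
  calc cτ * ‖w‖ ≤ ‖fderiv ℝ (tauNormalAff M J a C φ) p (0, w)‖ := hc
    _ = ‖J (fderiv ℝ φ (a p, C p.2) (A (v, 0), 0))‖ := h1
    _ ≤ ‖J‖ * ‖fderiv ℝ φ (a p, C p.2) (A (v, 0), 0)‖ := J.le_opNorm _
    _ ≤ ‖J‖ * (X * ‖A (v, 0)‖) := mul_le_mul_of_nonneg_left (hE1 _) (norm_nonneg _)

end Literature.Topology.FourManifolds
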